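import Literature.AlgebraicGeometry.Motives.EffectiveCartierSerreA
import Literature.AlgebraicGeometry.Motives.ProjectiveOfAmpleDivisor
import Literature.AlgebraicGeometry.Motives.GeneratingSectionsRatFn
import HarnessLib

/-!
# A multiple of an ample Cartier divisor is a hyperplane section of a projective embedding
# (Hartshorne II Thm. 7.6; Görtz–Wedhorn I Thm. 13.59 (2))

For an integral scheme `Z` proper over a field `k` and an AMPLE Cartier divisor `Θ` on `Z`
(`CartierDivisor.IsAmple`, Görtz–Wedhorn I Prop. 13.47 (iv): for some `d ≥ 1` every point lies in an
affine `Z_s`, `s ∈ Γ(Z, 𝒪(d • Θ))`), this file PROVES the scheme-theoretic content of "`𝓛` ample ⟹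
`𝓛^{⊗m}` very ample for some `m > 0`" (Hartshorne II Thm. 7.6; Görtz–Wedhorn I Thm. 13.59 (2),
(i) ⇒ (ii)) in the concrete model of `Motives/CartierDivisor`:

* `CartierDivisor.IsAmple.exists_smul_linEquiv_divisor` — **there are `q ≥ 1`, a closed immersion
  `ι : Z ↪ ℙⁿ_k` over `k` and a standard coordinate `x_{a₀}` with `q • Θ ∼ H_ι`**, `H_ι = div(ι^*x_{a₀})`
  the hyperplane divisor of `ι` (`GeneratingSections.divisor` of `GeneratingSections.ofHom ι`), i.e.
  `𝒪_Z(q • Θ) ≅ ι^*𝒪(1)`.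

The embedding is the one behind `CartierDivisor.IsAmple.isProjectiveOver` (`Motives/ProjectiveOfAmpleDivisor`):
finitely many sections `s_i ∈ Γ(Z, 𝒪(d • Θ))` with affine `Z_{s_i}` covering `Z` are generating
sections `G` (`CartierDivisor.toGeneratingSections`), and the chart-form construction
`GeneratingSections.embData` of `Motives/ProjectiveOfGeneratingSections` (Hartshorne II, proof of
Thm. 7.6 / Görtz–Wedhorn I, proof of Thm. 13.59: the sections `s_i^{⊗2N}` and `g̃ ⊗ s_i^{⊗N}` of
`𝓛^{⊗2N}`, `g` running through `k`-algebra generators of the `Γ(Z_{s_i}, 𝒪)`) defines a closed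
immersion `ι : Z ↪ ℙⁿ_k` — there only its EXISTENCE was recorded (`isProjectiveOver_of_isAffineOpen`);
here the morphism is kept (`GeneratingSections.isClosedImmersion_toProj_embData_reindex`) and its
hyperplane divisor is identified: the local equation of `H_ι = div(ι^*x_{(i₀, none)})` on the chart
`Z_{σ_m}` is `ι^*(x_{m₀}/x_m) = σ_{m₀}/σ_m` (`GeneratingSections.ratioFn_ofHom_toProj`, Hartshorne II
Thm. 7.1 (b)), where the rational function of a chart-form section `t = (t/s_i^e)_i` of `𝓛^{⊗e}`,
`𝓛 = 𝒪(d • Θ)`, is `(t/s_i^e) · s_i^e ∈ Γ(Z, 𝒪(e • (d • Θ)))`, independently of `i`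
(`GeneratingSections.ofSection_val_mul_pow_eq`, `isSection_ofSection_val_mul_pow`); with the unit
`h = σ_{m₀}` one gets `(d (2N)) • Θ + div(h) = H_ι` chart by chart.

Consumer: `HodgeTheory/AmpleDivisorChernClassNeZero` (`c₁(𝒪(Θ)) ≠ 0` for `Θ` ample, through
`c₁(𝒪(q • Θ)) = q · c₁(𝒪(Θ)) = c₁(𝒪(H_ι)) = -c₁(𝒪(-1)|_Z) ≠ 0`).

Everything is proved; no definitions, no named facts. Mathlib has no ample / very ample invertible
sheaves or Cartier divisors (cf. the module docstrings of `Motives/CartierDivisor`,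
`Motives/ProjectiveOfGeneratingSections`); the closed-immersion criteria used are the tree's
(`GeneratingSections.isClosedImmersion_of_restrict`, `isClosedImmersion_restrict_chart_none`).

## References

* R. Hartshorne, *Algebraic Geometry*, GTM 52, Springer (1977): II Thm. 7.1 (p. 150), II Prop. 7.2
  (p. 151), II Thm. 7.6 (p. 154) and its proof. [Hartshorne1977]
* U. Görtz, T. Wedhorn, *Algebraic Geometry I: Schemes*, 2nd ed., Springer Spektrum (2020),
  doi:10.1007/978-3-658-30733-2: Prop. 13.47 (p. 493), Def. 13.52 (p. 497), Thm. 13.59 (2) (p. 503)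
  and its proof. [GortzWedhorn2020]

#harness_tags algebraic_geometry.ample_divisors, algebraic_geometry.projective_varieties
-/

universe u

open CategoryTheory AlgebraicGeometry Limits TopologicalSpace Opposite
open Literature.AlgebraicGeometry.Motives.Segre Literature.AlgebraicGeometry.Motives.RatFn
open Literature.AlgebraicGeometry.Resolution (ofSection_mul ofSection_one)

noncomputable section

namespace Literature.AlgebraicGeometry.Motives

namespace RatFn

/-- The rational function of a restricted section (`GeneratingSections.rs`, the restriction map
`Γ(U, 𝒪_X) → Γ(W, 𝒪_X)` as a ring homomorphism) is that of the section (`RatFn.ofSection_map`).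
[folklore] -/
private theorem ofSection_rs {X : Scheme.{u}} [IsIntegral X] {U W : X.Opens} (h : W ≤ U)
    (hW : genericPoint X ∈ W) (σ : Γ(X, U)) :
    ofSection hW (GeneratingSections.rs h σ) = ofSection (h hW) σ :=
  ofSection_map (homOfLE h) hW σ

end RatFn

namespace GeneratingSections

/-! ### The rational function of a chart-form section of `𝒪(D₀)^{⊗e} = 𝒪(e • D₀)` -/

section SecFn

variable {X : Scheme.{u}} [IsIntegral X] (D₀ : CartierDivisor X) {ι : Type}
  (s : ι → X.functionField) (hs : ∀ i, D₀.IsSection (s i))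
  (hξ : ∀ i, genericPoint X ∈ D₀.nonvanishingOpens (s i))
  (hcov : ∀ x : X, ∃ i, x ∈ D₀.nonvanishing (s i)) {e : ℕ}

/-- **The rational function of a chart-form section does not depend on the chart.** For the
generating sections `G` of `𝓛 = 𝒪_X(D₀)` given by sections `s_i` (`CartierDivisor.toGeneratingSections`:
charts `X_{s_i}`, ratios `s_j/s_i`) and a section `t = (t/s_i^e)_i` of `𝓛^{⊗e}` in chart form
(`GeneratingSections.Sec`), the rational function `(t/s_i^e) · s_i^e ∈ K(X)` is the same for all `i`
(the transition rule `t/s_j^e = (t/s_i^e)(s_i/s_j)^e` of the trivialisations `𝒪|_{X_{s_i}} ≅ 𝓛|_{X_{s_i}}`,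
Görtz–Wedhorn I Remark 13.46 (2); Hartshorne II, proof of Thm. 7.6).
[cite: GortzWedhorn2020, Remark 13.46 (2) (p. 493) and Section (11.9) (p. 374)] -/
theorem ofSection_val_mul_pow_eq (t : (D₀.toGeneratingSections s hs hξ hcov).Sec e) (i j : ι) :
    ofSection (hξ i) (t.val i) * s i ^ e = ofSection (hξ j) (t.val j) * s j ^ e := by
  have hV : genericPoint X ∈ (D₀.toGeneratingSections s hs hξ hcov).V i j := by
    rw [(D₀.toGeneratingSections s hs hξ hcov).V_eq]
    exact ⟨hξ i, hξ j⟩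
  have h := congrArg (X.presheaf.germ ((D₀.toGeneratingSections s hs hξ hcov).V i j) (genericPoint X) hV)
    (t.compat i j)
  simp only [map_mul, map_pow, TopCat.Presheaf.germ_res_apply] at h
  -- `h : t_j = t_i * (s i / s j) ^ e` in `K(X)`
  have hr : X.presheaf.germ ((D₀.toGeneratingSections s hs hξ hcov).U j) (genericPoint X)
      ((homOfLE ((D₀.toGeneratingSections s hs hξ hcov).V_le_right i j)).le hV)
      ((D₀.toGeneratingSections s hs hξ hcov).ratio j i) = s i / s j :=
    D₀.germ_ratio s hs hξ j i _
  rw [hr] at h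
  have hsj : s j ≠ 0 := CartierDivisor.ne_zero_of_mem_nonvanishing (hξ j)
  change ofSection (hξ j) (t.val j) = ofSection (hξ i) (t.val i) * (s i / s j) ^ e at h
  rw [h, div_pow, mul_assoc, div_mul_cancel₀ _ (pow_ne_zero e hsj)]

/-- **A chart-form section of `𝓛^{⊗e}`, `𝓛 = 𝒪_X(D₀)`, IS a global section of `𝒪_X(e • D₀)`**: the
rational function `(t/s_i^e) · s_i^e` satisfies `f_c^e · ((t/s_j^e) s_j^e) = (t/s_j^e) (f_c s_j)^e`,
regular at every point of the chart `U_c` of `D₀` lying in `X_{s_j}` (and the `X_{s_j}` cover)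
(Görtz–Wedhorn I, (11.9): `Γ(X, 𝒪_X(D)) = {f ∈ K(X) ; f_i f ∈ Γ(U_i, 𝒪_X)}`, with Remark 13.46 (2);
Hartshorne II, proof of Thm. 7.6). [cite: GortzWedhorn2020, Section (11.9) (p. 374) and Remark 13.46 (2) (p. 493)] -/
theorem isSection_ofSection_val_mul_pow (t : (D₀.toGeneratingSections s hs hξ hcov).Sec e) (i : ι) :
    (e • D₀).IsSection (ofSection (hξ i) (t.val i) * s i ^ e) := by
  intro c y hyc
  obtain ⟨j, hyj⟩ := hcov y
  rw [ofSection_val_mul_pow_eq D₀ s hs hξ hcov t i j, CartierDivisor.smul_f,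
    show D₀.f c ^ e * (ofSection (hξ j) (t.val j) * s j ^ e) =
      ofSection (hξ j) (t.val j) * (D₀.f c * s j) ^ e by ring]
  have hyU : y ∈ (D₀.toGeneratingSections s hs hξ hcov).U j := hyj
  exact (isRegularAt_ofSection hyU (t.val j)).mul
    (((D₀.mem_nonvanishing_iff hyc).1 hyj).isRegularAt.pow e)

end SecFn

/-! ### The closed immersion defined by `embData` -/

section Embedding

variable {k : Type u} [Field k] {Z : SchemeOver k} [IsProper Z.hom] {ι : Type} [Fintype ι]
  (D : GeneratingSections ι Z.left) (hU : ∀ i, IsAffineOpen (D.U i))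

/-- **The morphism `Z → ℙⁿ_k` of the embedding data `embData` is a closed immersion** (for `Z`
proper over `k` carrying generating sections with finitely many affine charts `U i = Z_{s_i}`): it is
a closed immersion over the charts `D₊(x_{(i, none)})` (Hartshorne II Prop. 7.2, the tree's
`isClosedImmersion_restrict_chart_none`), whose preimages `U i` cover `Z`, and its image is closed
since `Z` is proper and `ℙⁿ_k → Spec k` separated. This is the proof of
`GeneratingSections.isProjectiveOver_of_isAffineOpen`, with the morphism kept
(Hartshorne II, proof of Thm. 7.6; Görtz–Wedhorn I, proof of Thm. 13.59).
[cite: Hartshorne1977, II Thm. 7.6 (p. 154) and its proof] -/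
theorem isClosedImmersion_toProj_embData_reindex {n : ℕ} (e : Fin (n + 1) ≃ D.Index Z.hom hU) :
    IsClosedImmersion (((D.embData Z.hom hU).reindex e).toProj Z.hom) := by
  have hV := fun a : {a : Fin (n + 1) // ∃ i, e a = ⟨i, none⟩} ↦
    D.isClosedImmersion_restrict_chart_none Z.hom hU e a.1 a.2
  refine isClosedImmersion_of_restrict (((D.embData Z.hom hU).reindex e).toProj Z.hom) _
    (D.iSup_preimage_chart_none Z.hom hU e) hV ?_
  -- the image is closed: `Z → ℙ` is universally closed as `Z` is proper and `ℙ → Spec k` separated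
  have h1 : UniversallyClosed (((D.embData Z.hom hU).reindex e).toProj Z.hom ≫
      toSpec (Fin (n + 1)) k) := by
    rw [toProj_toSpec]
    infer_instance
  have h2 : IsSeparated (toSpec (Fin (n + 1)) k) := by
    unfold toSpec
    infer_instance
  have h3 : UniversallyClosed (((D.embData Z.hom hU).reindex e).toProj Z.hom) :=
    .of_comp_of_isSeparated _ (toSpec (Fin (n + 1)) k)
  exact (((D.embData Z.hom hU).reindex e).toProj Z.hom).isClosedMap.isClosed_range

/-- The rational function of the ratio `σ_{m'}/σ_m` of the embedding data, multiplied by that of the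
home-chart value of `σ_m`, is that of the home-chart value of `σ_{m'}`:
`(σ_{m'}/σ_m) · (σ_m/s_i^{2N}) = σ_{m'}/s_i^{2N}` in `K(Z)`, `i` the home chart of `m`
(`ratio'_mul_num` read at the generic point). [folklore] -/
private theorem ofSection_embData_ratio_mul [IsIntegral Z.left] (m m' : D.Index Z.hom hU)
    (hm : genericPoint Z.left ∈ (D.embData Z.hom hU).U m) (hi : genericPoint Z.left ∈ D.U m.1) :
    ofSection hm ((D.embData Z.hom hU).ratio m m') * ofSection hi ((D.newSec Z.hom hU m).val m.1) =
      ofSection hi ((D.newSec Z.hom hU m').val m.1) := by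
  have h := congrArg (ofSection (U := D.U' Sigma.fst (D.newSec Z.hom hU) m) hm)
    (D.ratio'_mul_num Sigma.fst (D.newSec Z.hom hU) m m')
  rw [ofSection_mul, ofSection_rs, ofSection_rs] at h
  exact h

end Embedding

end GeneratingSections

/-! ### Ample divisors: a multiple is a hyperplane section of a closed immersion -/

namespace CartierDivisor

variable {k : Type u} [Field k] {Z : SchemeOver k} [IsIntegral Z.left] [IsProper Z.hom]
  {Θ : CartierDivisor Z.left}

omit [IsProper Z.hom] in
/-- The data of Görtz–Wedhorn I, Prop. 13.47 (iv) for `𝓛 = 𝒪(Θ)` ample, with the sections kept: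
`d ≥ 1` and finitely many sections `s_0, …, s_n ∈ Γ(Z, 𝒪(d • Θ))` (indexed by `Fin (n + 1)`, `Z`
being nonempty) whose non-vanishing loci `Z_{s_i}` are affine, contain the generic point and cover
`Z` (finitely many of the affine `Z_s` of `IsAmple` cover the quasi-compact `Z`; cf.
`IsAmple.exists_generatingSections`, which forgets the `s_i`). [cite: GortzWedhorn2020, Prop. 13.47 (iv) (p. 493)] -/
theorem IsAmple.exists_sections_cover_affine (hΘ : Θ.IsAmple) :
    ∃ (d : ℕ) (_ : 0 < d) (n : ℕ) (s : Fin (n + 1) → Z.left.functionField),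
      (∀ i, (d • Θ).IsSection (s i)) ∧ (∀ i, genericPoint Z.left ∈ (d • Θ).nonvanishingOpens (s i)) ∧
      (∀ x : Z.left, ∃ i, x ∈ (d • Θ).nonvanishing (s i)) ∧
      ∀ i, IsAffineOpen ((d • Θ).nonvanishingOpens (s i)) := by
  classical
  obtain ⟨hc, _, d, hd, h⟩ := hΘ
  choose s hs hmem haff using h
  let V : Z.left → Set Z.left := fun x => ((d • Θ).nonvanishingOpens (s x) : Set Z.left)
  have hcover : (Set.univ : Set Z.left) ⊆ ⋃ x, V x := fun x _ => Set.mem_iUnion.2 ⟨x, hmem x⟩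
  obtain ⟨t, ht⟩ := isCompact_univ.elim_finite_subcover V
    (fun x => ((d • Θ).nonvanishingOpens (s x)).isOpen) hcover
  have htne : t.Nonempty := by
    obtain ⟨x⟩ := (inferInstance : Nonempty Z.left)
    obtain ⟨y, hy, -⟩ := Set.mem_iUnion₂.1 (ht (Set.mem_univ x))
    exact ⟨y, hy⟩
  obtain ⟨n, hn⟩ : ∃ n, t.card = n + 1 :=
    Nat.exists_eq_succ_of_ne_zero (Finset.card_ne_zero.2 htne)
  let e : Fin (n + 1) ≃ ↥t := (t.equivFin.trans (finCongr hn)).symm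
  refine ⟨d, hd, n, fun i => s (e i), fun i => hs _, fun i => genericPoint_mem_of_mem (hmem (e i)),
    fun x => ?_, fun i => haff _⟩
  obtain ⟨y, hy, hxy⟩ := Set.mem_iUnion₂.1 (ht (Set.mem_univ x))
  refine ⟨e.symm ⟨y, hy⟩, ?_⟩
  simp only [Equiv.apply_symm_apply]
  exact hxy

/-- **A multiple of an ample divisor is a hyperplane section of a projective embedding**
(Hartshorne II Thm. 7.6: "`𝓛` is ample iff `𝓛^m` is very ample over `Spec A` for some `m > 0`";
Görtz–Wedhorn I Thm. 13.59 (2), (i) ⇒ (ii); very ample = `𝓛^{⊗m} ≅ ι^*𝒪(1)` for an immersion `ι`,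
Hartshorne II §5 p. 120 / Görtz–Wedhorn I Def. 13.52, here a CLOSED immersion since `Z` is proper):
for `Θ` ample on the integral proper `k`-scheme `Z` there are `q ≥ 1`, a closed `k`-immersion
`ι : Z ↪ ℙⁿ_k` and a coordinate `x_{a₀}` (with `Z ⊄ V(x_{a₀})`) such that **`q • Θ ∼ H_ι`**,
`H_ι = div(ι^*x_{a₀})` the hyperplane divisor (`GeneratingSections.divisor` of
`GeneratingSections.ofHom ι`). Proof: the module docstring (the embedding `embData` of the generating
sections `s_i ∈ Γ(Z, 𝒪(d • Θ))` with affine `Z_{s_i}`; `q = d · 2N`; unit `h = σ_{(i₀, none)}`).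
[cite: Hartshorne1977, II Thm. 7.6 (p. 154)] [cite: GortzWedhorn2020, Thm. 13.59 (2) (p. 503)] -/
theorem IsAmple.exists_smul_linEquiv_divisor (hΘ : Θ.IsAmple) :
    ∃ (q n : ℕ) (ι : Z ⟶ projectiveSpace n k) (_ : IsClosedImmersion ι.left) (a₀ : Fin (n + 1))
      (ha₀ : genericPoint Z.left ∈ (GeneratingSections.ofHom ι.left).U a₀),
      0 < q ∧ (q • Θ).LinEquiv ((GeneratingSections.ofHom ι.left).divisor a₀ ha₀) := by
  classical
  obtain ⟨d, hd, n', s, hs, hξ, hcov, haff⟩ := hΘ.exists_sections_cover_affine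
  have hs0 : ∀ i, s i ≠ 0 := fun i => ne_zero_of_mem_nonvanishing (hξ i)
  -- the generating sections `G` of `𝒪(d • Θ)` with affine charts `Z_{s_i}`
  set G : GeneratingSections (Fin (n' + 1)) Z.left := (d • Θ).toGeneratingSections s hs hξ hcov with hG
  have hU : ∀ i, IsAffineOpen (G.U i) := fun i => haff i
  -- the embedding data, reindexed by `Fin (n + 1)`, and its closed immersion `ι₀ : Z ⟶ ℙⁿ`
  set i₀ : Fin (n' + 1) := 0 with hi₀
  have hcard : Fintype.card (G.Index Z.hom hU) = (Fintype.card (G.Index Z.hom hU) - 1) + 1 :=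
    (Nat.sub_add_cancel (Fintype.card_pos_iff.mpr ⟨⟨i₀, none⟩⟩)).symm
  set n := Fintype.card (G.Index Z.hom hU) - 1 with hn
  set e : Fin (n + 1) ≃ G.Index Z.hom hU := (Fintype.equivFinOfCardEq hcard).symm with he
  set G' : GeneratingSections (Fin (n + 1)) Z.left := (G.embData Z.hom hU).reindex e with hG'
  have hι : IsClosedImmersion (G'.toProjectiveSpace (Z := Z)).left := by
    rw [GeneratingSections.toProjectiveSpace_left]
    exact G.isClosedImmersion_toProj_embData_reindex hU e
  -- the coordinate `a₀ ↔ (i₀, none)`: `ι₀⁻¹D₊(x_{a₀}) = Z_{s_{i₀}^{2N}} = Z_{s_{i₀}}`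
  set a₀ : Fin (n + 1) := e.symm ⟨i₀, none⟩ with ha₀def
  have hea₀ : e a₀ = ⟨i₀, none⟩ := by rw [ha₀def, Equiv.apply_symm_apply]
  have hU'a : ∀ a, (GeneratingSections.ofHom (G'.toProjectiveSpace (Z := Z)).left).U a = G'.U a :=
    fun a => by
      change G'.toProj Z.hom ⁻¹ᵁ ProjSpace.U a = G'.U a
      exact G'.toProj_preimage_U Z.hom a
  have hG'U : ∀ a, G'.U a = Z.left.basicOpen ((G.newSec Z.hom hU (e a)).val (e a).1) := fun a => rfl
  have hG'U₀ : G'.U a₀ = G.U i₀ := by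
    rw [hG', GeneratingSections.reindex_U, hea₀]
    exact G.embData_U_none Z.hom hU i₀
  have ha₀ : genericPoint Z.left ∈
      (GeneratingSections.ofHom (G'.toProjectiveSpace (Z := Z)).left).U a₀ := by
    rw [hU'a, hG'U₀]
    exact hξ i₀
  -- the unit `h = σ_{m₀}`, `m₀ = e a₀ = (i₀, none)`: `h = (σ_{m₀}/s_j^{2N}) · s_j^{2N}` for any `j`
  set m₀ : G.Index Z.hom hU := e a₀ with hm₀
  obtain ⟨h, hh⟩ : ∃ h : Z.left.functionField,
      h = ofSection (hξ m₀.1) ((G.newSec Z.hom hU m₀).val m₀.1) *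
        s m₀.1 ^ (G.deg Z.hom hU + G.deg Z.hom hU) := ⟨_, rfl⟩
  have hσ₀ : ofSection (hξ m₀.1) ((G.newSec Z.hom hU m₀).val m₀.1) ≠ 0 := by
    rw [← genericPoint_mem_basicOpen_iff]
    have hξ₀ : genericPoint Z.left ∈ G'.U a₀ := by
      rw [hG'U₀]
      exact hξ i₀
    exact hξ₀
  have hh0 : h ≠ 0 := by
    rw [hh]
    exact mul_ne_zero hσ₀ (pow_ne_zero _ (hs0 _))
  refine ⟨d * (G.deg Z.hom hU + G.deg Z.hom hU), n, G'.toProjectiveSpace, hι, a₀, ha₀,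
    Nat.mul_pos hd (Nat.add_pos_left (G.deg_pos Z.hom hU) _), ?_⟩
  rw [CartierDivisor.linEquiv_iff]
  refine ⟨h, hh0, ?_⟩
  rintro c ⟨⟨a, ha⟩⟩ x hxc hxa
  -- notation: `m = e a` with home chart `i = m.1`
  set m : G.Index Z.hom hU := e a with hmdef
  have hxa' : x ∈ G'.U a := by rwa [← hU'a a]
  have hxB : x ∈ Z.left.basicOpen ((G.newSec Z.hom hU m).val m.1) := by rwa [hG'U a] at hxa'
  have hxi : x ∈ G.U m.1 := Z.left.basicOpen_le _ hxB
  have hξa : genericPoint Z.left ∈ G'.U a := genericPoint_mem_of_mem hxa'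
  have hξi : genericPoint Z.left ∈ G.U m.1 := hξ m.1
  -- the local equation of `H_ι` on `ι₀⁻¹D₊(x_a) = Z_{σ_m}` is `ι₀^*(x_{a₀}/x_a) = σ_{m₀}/σ_m`
  have hf : (GeneratingSections.ofHom (G'.toProjectiveSpace (Z := Z)).left).ratioFn a a₀ ha =
      ofSection hξa ((G.embData Z.hom hU).ratio m m₀) :=
    G'.ratioFn_ofHom_toProj Z.hom a a₀ ha hξa
  -- `(σ_{m₀}/σ_m) · (σ_m/s_i^{2N}) = σ_{m₀}/s_i^{2N}` and `h = (σ_{m₀}/s_i^{2N}) s_i^{2N}`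
  have key := G.ofSection_embData_ratio_mul hU m m₀ hξa hξi
  have hh' : h = ofSection hξi ((G.newSec Z.hom hU m₀).val m.1) *
      s m.1 ^ (G.deg Z.hom hU + G.deg Z.hom hU) := by
    rw [hh]
    exact GeneratingSections.ofSection_val_mul_pow_eq (d • Θ) s hs hξ hcov
      (G.newSec Z.hom hU m₀) m₀.1 m.1
  have hσm0 : ofSection hξi ((G.newSec Z.hom hU m).val m.1) ≠ 0 := by
    rw [← genericPoint_mem_basicOpen_iff]
    exact genericPoint_mem_of_mem hxB
  have hσm₀0 : ofSection hξi ((G.newSec Z.hom hU m₀).val m.1) ≠ 0 := by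
    intro h0
    exact hh0 (by rw [hh', h0, zero_mul])
  have hq : ofSection hξa ((G.embData Z.hom hU).ratio m m₀) =
      ofSection hξi ((G.newSec Z.hom hU m₀).val m.1) /
        ofSection hξi ((G.newSec Z.hom hU m).val m.1) :=
    (eq_div_iff hσm0).2 key
  -- the quotient of the local equations is the unit `(f_c^d s_i)^{2N} · (σ_m/s_i^{2N})` at `x`
  change IsUnitAt x (Θ.f c ^ (d * (G.deg Z.hom hU + G.deg Z.hom hU)) * h /
    (GeneratingSections.ofHom (G'.toProjectiveSpace (Z := Z)).left).ratioFn a a₀ ha)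
  have e1 : Θ.f c ^ (d * (G.deg Z.hom hU + G.deg Z.hom hU)) * h /
      (GeneratingSections.ofHom (G'.toProjectiveSpace (Z := Z)).left).ratioFn a a₀ ha =
      (Θ.f c ^ d * s m.1) ^ (G.deg Z.hom hU + G.deg Z.hom hU) *
        ofSection hξi ((G.newSec Z.hom hU m).val m.1) := by
    rw [hf, hq, hh', pow_mul]
    field_simp
    ring
  rw [e1]
  have hu1 : IsUnitAt x (Θ.f c ^ d * s m.1) := ((d • Θ).mem_nonvanishing_iff hxc).1 hxi
  have hu2 : IsUnitAt x (ofSection hξi ((G.newSec Z.hom hU m).val m.1)) :=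
    (isUnitAt_ofSection_iff hxi _).2 hxB
  exact (hu1.pow _).mul hu2

/-- The same with the exponent in front: **for `Θ` ample some `q • Θ`, `q ≥ 1`, is linearly
equivalent to the hyperplane divisor of a closed immersion `Z ↪ ℙⁿ_k`** — the form consumed by the
Chern-class computation `c₁(𝒪(q • Θ)) = q · c₁(𝒪(Θ)) = c₁(𝒪(H_ι)) ≠ 0`
(`HodgeTheory/AmpleDivisorChernClassNeZero`). [cite: Hartshorne1977, II Thm. 7.6 (p. 154)] -/
theorem IsAmple.exists_pos_smul_linEquiv_hyperplaneDivisor (hΘ : Θ.IsAmple) :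
    ∃ q : ℕ, 0 < q ∧ ∃ (n : ℕ) (ι : Z ⟶ projectiveSpace n k) (_ : IsClosedImmersion ι.left)
      (a₀ : Fin (n + 1)) (ha₀ : genericPoint Z.left ∈ (GeneratingSections.ofHom ι.left).U a₀),
      (q • Θ).LinEquiv ((GeneratingSections.ofHom ι.left).divisor a₀ ha₀) := by
  obtain ⟨q, n, ι, hι, a₀, ha₀, hq, hlin⟩ := hΘ.exists_smul_linEquiv_divisor
  exact ⟨q, hq, n, ι, hι, a₀, ha₀, hlin⟩

end CartierDivisor

end Literature.AlgebraicGeometry.Motives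

end
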